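import Literature.NumberTheory.Automorphic.FiniteAdeleFactorizable
import Literature.NumberTheory.Automorphic.GLnIntegralPrimitiveTransitive
import HarnessLib

/-!
# Balls `{x : v(x_i) ≤ q^{-m}}` in `F_vᴺ`: Schwartz–Bruhat indicators, content decomposition, linear independence

Topic `NumberTheory/Automorphic`; namespace `Literature.NumberTheory.Automorphic.AdicBall`.  KERNEL ONLY: theorems,
0 definitions, 0 records, 0 named facts, 0 sorry.

For a number field `F`, a finite place `v` and `N : ℕ`, the BALLS `B_m = {x ∈ F_vᴺ | v(x_i) ≤ exp(-m) ∀ i}` (`m ∈ ℤ`;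
`B_0 = 𝒪_vᴺ` is the tree's `integralBox`, `1_{B_0}` its `unitVec`) are the scaled lattices `ϖ^m 𝒪_vᴺ`:

* §1 `mem_ball_zero_iff`, `smul_zpow_mem_ball_iff` (`π^k • x ∈ B_{m+k} ↔ x ∈ B_m` for a uniformiser `π`),
  `isCompact_ball`, `isClopen_ball`, **`indicator_ball_mem_schwartzBruhat`** (`1_{B_m} ∈ 𝒮(F_vᴺ)`);
* §2 **content**: every `x ≠ 0` is `π^k • x₀` with `x₀ ∈ 𝒪_vᴺ` PRIMITIVE (some coordinate a unit)
  (`exists_zpow_smul_primitive_eq`), and then `x ∈ B_m ↔ m ≤ k` (`zpow_smul_mem_ball_iff_le`);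
* §3 **`linearIndependent_indicator_ball`** — for `N ≥ 1` the indicators `(1_{B_m})_{m ∈ ℤ}` are linearly independent
  (evaluate at `π^m e₀`).

These are the model-side ingredients of the spherical hypothesis (SPH) of `Liu2021/Def411WeilCarriersSurvivalSplit` (in
the Schrödinger model attached to the eigen-Lagrangian of a split centre the `GL_N(𝒪_v)`-spherical vectors are the
`1_{B_m}`, shifted by the central uniformiser), together with `GLnIntegralPrimitiveTransitive` (invariant functions are
constant on the shells `B_m ∖ B_{m+1}`).

## References
* [BernsteinZelevinsky1976] I. N. Bernstein, A. V. Zelevinsky, Russian Math. Surveys 31 (1976), §2 (spherical vectors,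
  lattices in `Fⁿ`).
* [CasselsFrohlichANT1967] Ch. II §§4–7 (valuations, `𝒪_v`, uniformisers).
-/

set_option autoImplicit false

noncomputable section

open scoped Matrix
open NumberField IsDedekindDomain

namespace Literature.NumberTheory.Automorphic.AdicBall

variable {F : Type} [Field F] [NumberField F] (v : HeightOneSpectrum (𝓞 F)) (N : ℕ)

/- Throughout, the ball `B_m` is written `{x : Fin N → v.adicCompletion F | ∀ i, Valued.v (x i) ≤ WithZero.exp (-m)}`
(no definition is introduced). -/

/-! ## §1 Balls are scaled integral boxes; their indicators are Schwartz–Bruhat -/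

/-- `B_0 = 𝒪_vᴺ` (the tree's `integralBox`). [cite: CasselsFrohlichANT1967, Ch. II §4] -/
theorem ball_zero_eq_integralBox : {x : Fin N → v.adicCompletion F | ∀ i, Valued.v (x i) ≤ WithZero.exp (-(0 : ℤ))} = integralBox F (Fin N) v := by
  ext x
  simp only [Set.mem_setOf_eq, neg_zero, WithZero.exp_zero, mem_integralBox_iff,
    HeightOneSpectrum.mem_adicCompletionIntegers]

/-- **scaling**: for `π` with `v(π) = exp(-1)` and `k ∈ ℤ`, `π^k • x ∈ B_{m+k} ↔ x ∈ B_m`.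
[cite: CasselsFrohlichANT1967, Ch. II §4] -/
theorem smul_zpow_mem_ball_iff {π : v.adicCompletion F} (hπ : Valued.v π = WithZero.exp (-1 : ℤ)) (k m : ℤ)
    (x : Fin N → v.adicCompletion F) : (π ^ k • x ∈ {x : Fin N → v.adicCompletion F | ∀ i, Valued.v (x i) ≤ WithZero.exp (-(m + k : ℤ))}) ↔ x ∈ {x : Fin N → v.adicCompletion F | ∀ i, Valued.v (x i) ≤ WithZero.exp (-(m : ℤ))} := by
  have hπ0 : π ≠ 0 := fun h => by rw [h, map_zero] at hπ; exact WithZero.exp_ne_zero hπ.symm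
  have hk : Valued.v (π ^ k) = WithZero.exp (-k) := by
    rw [map_zpow₀, hπ, ← WithZero.exp_zsmul, smul_eq_mul, mul_neg_one]
  have hk0' : WithZero.exp (-k : ℤ) ≠ 0 := WithZero.exp_ne_zero
  simp only [Set.mem_setOf_eq, Pi.smul_apply, smul_eq_mul, map_mul, hk]
  refine forall_congr' fun i => ?_
  rw [show WithZero.exp (-(m + k : ℤ)) = WithZero.exp (-k) * WithZero.exp (-(m : ℤ)) by
    rw [← WithZero.exp_add]; ring_nf]
  constructor
  · intro h
    have h' := mul_le_mul' (le_refl (WithZero.exp (-k))⁻¹) h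
    rwa [inv_mul_cancel_left₀ hk0', inv_mul_cancel_left₀ hk0'] at h'
  · intro h
    exact mul_le_mul' le_rfl h

/-- `B_m` is the image of `B_0 = 𝒪_vᴺ` under `x ↦ π^m • x`. [cite: CasselsFrohlichANT1967, Ch. II §4] -/
theorem ball_eq_image_smul {π : v.adicCompletion F} (hπ : Valued.v π = WithZero.exp (-1 : ℤ)) (m : ℤ) :
    {x : Fin N → v.adicCompletion F | ∀ i, Valued.v (x i) ≤ WithZero.exp (-(m : ℤ))} = (fun x : Fin N → v.adicCompletion F => π ^ m • x) '' {x : Fin N → v.adicCompletion F | ∀ i, Valued.v (x i) ≤ WithZero.exp (-(0 : ℤ))} := by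
  have hπ0 : π ≠ 0 := fun h => by rw [h, map_zero] at hπ; exact WithZero.exp_ne_zero hπ.symm
  ext x
  constructor
  · intro hx
    refine ⟨π ^ (-m) • x, ?_, ?_⟩
    · have := (smul_zpow_mem_ball_iff v N hπ (-m) m x).symm
      rw [add_neg_cancel] at this
      exact this.1 hx
    · simp only [smul_smul, ← zpow_add₀ hπ0, add_neg_cancel, zpow_zero, one_smul]
  · rintro ⟨y, hy, rfl⟩
    have := (smul_zpow_mem_ball_iff v N hπ m 0 y).2 hy
    rwa [zero_add] at this

/-- a uniformiser of `F_v` coming from `F` (valuation `exp (-1)`). [cite: CasselsFrohlichANT1967, Ch. II §4] -/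
theorem exists_valued_uniformiser : ∃ π : v.adicCompletion F, Valued.v π = WithZero.exp (-1 : ℤ) := by
  obtain ⟨π, hπ⟩ := IsDedekindDomain.HeightOneSpectrum.valuation_exists_uniformizer F v
  exact ⟨(π : v.adicCompletion F), by rw [IsDedekindDomain.HeightOneSpectrum.valuedAdicCompletion_eq_valuation', hπ]⟩

/-- **`B_m` is compact** (a scaled copy of the compact `𝒪_vᴺ`). [cite: CasselsFrohlichANT1967, Ch. II §7] -/
theorem isCompact_ball (m : ℤ) : IsCompact ({x : Fin N → v.adicCompletion F | ∀ i, Valued.v (x i) ≤ WithZero.exp (-(m : ℤ))}) := by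
  obtain ⟨π, hπ⟩ := exists_valued_uniformiser v
  rw [ball_eq_image_smul v N hπ m, ball_zero_eq_integralBox]
  exact (isCompact_integralBox F (Fin N) v).image (continuous_const_smul _)

/-- **`B_m` is clopen**. [cite: CasselsFrohlichANT1967, Ch. II §7] -/
theorem isClopen_ball (m : ℤ) : IsClopen ({x : Fin N → v.adicCompletion F | ∀ i, Valued.v (x i) ≤ WithZero.exp (-(m : ℤ))}) := by
  obtain ⟨π, hπ⟩ := exists_valued_uniformiser v
  have hπ0 : π ≠ 0 := fun h => by rw [h, map_zero] at hπ; exact WithZero.exp_ne_zero hπ.symm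
  -- `B_m` is the preimage of `B_0` under the homeomorphism `x ↦ π^{-m} • x`
  have hpre : {x : Fin N → v.adicCompletion F | ∀ i, Valued.v (x i) ≤ WithZero.exp (-(m : ℤ))} = (fun x : Fin N → v.adicCompletion F => π ^ (-m) • x) ⁻¹' {x : Fin N → v.adicCompletion F | ∀ i, Valued.v (x i) ≤ WithZero.exp (-(0 : ℤ))} := by
    ext x
    have := (smul_zpow_mem_ball_iff v N hπ (-m) m x)
    rw [add_neg_cancel] at this
    exact this.symm
  rw [hpre, ball_zero_eq_integralBox]
  exact (isClopen_integralBox F (Fin N) v).preimage (continuous_const_smul _)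

/-- **`1_{B_m}` is a Schwartz–Bruhat function on `F_vᴺ`.** [cite: BernsteinZelevinsky1976, §2] -/
theorem indicator_ball_mem_schwartzBruhat (m : ℤ) :
    ({x : Fin N → v.adicCompletion F | ∀ i, Valued.v (x i) ≤ WithZero.exp (-(m : ℤ))}).indicator (fun _ => (1 : ℂ)) ∈ SchwartzBruhat (Fin N → v.adicCompletion F) :=
  indicator_one_mem_schwartzBruhat (isClopen_ball v N m) (isCompact_ball v N m)

/-! ## §2 Content: `x = π^k • x₀` with `x₀` primitive -/

/-- **content decomposition**: for `x ≠ 0` and a uniformiser `π`, `x = π^k • x₀` with `x₀ ∈ 𝒪_vᴺ` having a unit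
coordinate. [cite: CasselsFrohlichANT1967, Ch. II §4] -/
theorem exists_zpow_smul_primitive_eq {π : v.adicCompletion F} (hπ : Valued.v π = WithZero.exp (-1 : ℤ))
    {x : Fin N → v.adicCompletion F} (hx : x ≠ 0) :
    ∃ (k : ℤ) (x₀ : Fin N → v.adicCompletion F), (∀ i, Valued.v (x₀ i) ≤ 1) ∧ (∃ i₀, Valued.v (x₀ i₀) = 1) ∧
      x = π ^ k • x₀ := by
  classical
  have hπ0 : π ≠ 0 := fun h => by rw [h, map_zero] at hπ; exact WithZero.exp_ne_zero hπ.symm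
  -- a coordinate of maximal valuation
  obtain ⟨j, hj⟩ : ∃ j, x j ≠ 0 := Function.ne_iff.1 hx
  obtain ⟨i₀, -, hi₀⟩ := Finset.exists_max_image Finset.univ (fun i => Valued.v (x i)) ⟨j, Finset.mem_univ j⟩
  set γ := Valued.v (x i₀) with hγ
  have hγ0 : γ ≠ 0 := by
    intro h0
    have := hi₀ j (Finset.mem_univ j)
    rw [h0, le_zero_iff] at this
    exact hj ((Valuation.zero_iff _).1 this)
  have key : WithZero.exp (-WithZero.log γ) * γ = 1 := by
    calc WithZero.exp (-WithZero.log γ) * γ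
        = WithZero.exp (-WithZero.log γ) * WithZero.exp (WithZero.log γ) := by rw [WithZero.exp_log hγ0]
      _ = 1 := by rw [← WithZero.exp_add, neg_add_cancel, WithZero.exp_zero]
  -- `x₀ := π^{log γ} • x`, `k := -log γ`
  refine ⟨-WithZero.log γ, π ^ WithZero.log γ • x, fun i => ?_, ⟨i₀, ?_⟩, ?_⟩
  · rw [Pi.smul_apply, smul_eq_mul, map_mul, map_zpow₀, hπ, ← WithZero.exp_zsmul, smul_eq_mul, mul_neg_one]
    calc WithZero.exp (-WithZero.log γ) * Valued.v (x i)
        ≤ WithZero.exp (-WithZero.log γ) * γ := mul_le_mul' le_rfl (hi₀ i (Finset.mem_univ i))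
      _ = 1 := key
  · rw [Pi.smul_apply, smul_eq_mul, map_mul, map_zpow₀, hπ, ← WithZero.exp_zsmul, smul_eq_mul, mul_neg_one, ← hγ]
    exact key
  · rw [smul_smul, ← zpow_add₀ hπ0, neg_add_cancel, zpow_zero, one_smul]

/-- **balls in terms of content**: for `x₀` primitive, `π^k • x₀ ∈ B_m ↔ m ≤ k`.
[cite: CasselsFrohlichANT1967, Ch. II §4] -/
theorem zpow_smul_mem_ball_iff_le {π : v.adicCompletion F} (hπ : Valued.v π = WithZero.exp (-1 : ℤ)) (k m : ℤ)
    {x₀ : Fin N → v.adicCompletion F} (hx₀ : ∀ i, Valued.v (x₀ i) ≤ 1) {i₀ : Fin N} (hx₀₁ : Valued.v (x₀ i₀) = 1) :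
    π ^ k • x₀ ∈ {x : Fin N → v.adicCompletion F | ∀ i, Valued.v (x i) ≤ WithZero.exp (-(m : ℤ))} ↔ m ≤ k := by
  have h := smul_zpow_mem_ball_iff v N hπ k (m - k) x₀
  rw [sub_add_cancel] at h
  rw [h]
  simp only [Set.mem_setOf_eq]
  constructor
  · intro hm
    have := hm i₀
    rw [hx₀₁, ← WithZero.exp_zero, WithZero.exp_le_exp] at this
    linarith
  · intro hm i
    refine (hx₀ i).trans ?_
    rw [← WithZero.exp_zero, WithZero.exp_le_exp]
    linarith

/-! ## §3 Linear independence of the ball indicators -/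

/-- **the indicators `1_{B_m}`, `m ∈ ℤ`, are linearly independent** (`N ≥ 1`; evaluate a vanishing combination at the
vectors `π^m e₀`, which lie in `B_k` exactly for `k ≤ m`). [cite: BernsteinZelevinsky1976, §2] -/
theorem linearIndependent_indicator_ball (hN : 0 < N) :
    LinearIndependent ℂ (fun m : ℤ => ({x : Fin N → v.adicCompletion F | ∀ i, Valued.v (x i) ≤ WithZero.exp (-(m : ℤ))}).indicator (fun _ => (1 : ℂ)) : ℤ → (Fin N → v.adicCompletion F) → ℂ) := by
  classical
  obtain ⟨π, hπ⟩ := exists_valued_uniformiser v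
  rw [linearIndependent_iff']
  intro s g hg
  -- the test vectors `π^m e₀` and the partial sums `S m = Σ_{k ∈ s, k ≤ m} g k`
  let i₀ : Fin N := ⟨0, hN⟩
  let e : Fin N → v.adicCompletion F := Pi.single i₀ 1
  have he : ∀ i, Valued.v (e i) ≤ 1 := fun i => by
    simp only [e, Pi.single_apply]
    split_ifs
    · rw [map_one]
    · rw [map_zero]; exact zero_le_one
  have he₁ : Valued.v (e i₀) = 1 := by simp only [e, Pi.single_eq_same, map_one]
  have hS : ∀ m : ℤ, ∑ k ∈ s.filter (· ≤ m), g k = 0 := by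
    intro m
    have h := congrFun hg (π ^ m • e)
    rw [Finset.sum_apply, Pi.zero_apply] at h
    rw [Finset.sum_filter]
    refine Eq.trans (Finset.sum_congr rfl fun k _ => ?_) h
    rw [Pi.smul_apply, smul_eq_mul]
    by_cases hk : k ≤ m
    · rw [if_pos hk, Set.indicator_of_mem ((zpow_smul_mem_ball_iff_le v N hπ m k he he₁).2 hk), mul_one]
    · rw [if_neg hk, Set.indicator_of_notMem (fun hmem => hk ((zpow_smul_mem_ball_iff_le v N hπ m k he he₁).1 hmem)),
        mul_zero]
  -- `g m = S m - S (m - 1) = 0`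
  intro m hm
  have h1 := hS m
  have h2 := hS (m - 1)
  have hsplit : ∑ k ∈ s.filter (· ≤ m), g k = (∑ k ∈ s.filter (· ≤ m - 1), g k) + g m := by
    have hset : s.filter (· ≤ m) = insert m (s.filter (· ≤ m - 1)) := by
      ext k
      simp only [Finset.mem_filter, Finset.mem_insert]
      constructor
      · rintro ⟨hk, hkm⟩
        rcases lt_or_eq_of_le hkm with h | h
        · exact Or.inr ⟨hk, by omega⟩
        · exact Or.inl h
      · rintro (rfl | ⟨hk, hkm⟩)
        · exact ⟨hm, le_rfl⟩
        · exact ⟨hk, by omega⟩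
    rw [hset, Finset.sum_insert (by simp), add_comm]
  rw [hsplit, h2, zero_add] at h1
  exact h1

/-! ## §4 Balls exhaust `F_vᴺ` and shrink to `0`; a Schwartz–Bruhat function lives between two balls -/

/-- every vector lies in some ball `B_{-n}`, `n ∈ ℕ`. [cite: CasselsFrohlichANT1967, Ch. II §4] -/
theorem exists_mem_ball_neg_nat (x : Fin N → v.adicCompletion F) :
    ∃ n : ℕ, x ∈ {x : Fin N → v.adicCompletion F | ∀ i, Valued.v (x i) ≤ WithZero.exp (-(-(n : ℤ) : ℤ))} := by
  classical
  -- `n := max_i (log v(x_i)).toNat`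
  refine ⟨Finset.univ.sup fun i => (WithZero.log (Valued.v (x i))).toNat, fun i => ?_⟩
  rw [neg_neg]
  by_cases h0 : Valued.v (x i) = 0
  · rw [h0]; exact zero_le
  · rw [← WithZero.log_le_iff_le_exp h0]
    have h1 : WithZero.log (Valued.v (x i)) ≤ ((WithZero.log (Valued.v (x i))).toNat : ℤ) := Int.self_le_toNat _
    have h2 : (WithZero.log (Valued.v (x i))).toNat ≤ Finset.univ.sup fun i => (WithZero.log (Valued.v (x i))).toNat :=
      Finset.le_sup (f := fun i => (WithZero.log (Valued.v (x i))).toNat) (Finset.mem_univ i)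
    exact h1.trans (by exact_mod_cast h2)

/-- only `0` lies in every ball `B_m`, `m ∈ ℕ`. [cite: CasselsFrohlichANT1967, Ch. II §4] -/
theorem eq_zero_of_forall_mem_ball (x : Fin N → v.adicCompletion F) (hx : ∀ m : ℕ, x ∈ {x : Fin N → v.adicCompletion F | ∀ i, Valued.v (x i) ≤ WithZero.exp (-((m : ℤ) : ℤ))}) : x = 0 := by
  funext i
  by_contra h
  have h0 : Valued.v (x i) ≠ 0 := (Valuation.ne_zero_iff _).2 h
  -- `v(x_i) = exp a`; take `m > -a`
  set a := WithZero.log (Valued.v (x i)) with ha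
  have h1 := hx ((-a).toNat + 1) i
  rw [← WithZero.exp_log h0, ← ha, WithZero.exp_le_exp] at h1
  have h2 : -a ≤ ((-a).toNat : ℤ) := Int.self_le_toNat _
  push_cast at h1
  omega

/-- **a Schwartz–Bruhat function on `F_vᴺ` vanishes off some ball** (compact support; the open balls `B_{-n}` exhaust
`F_vᴺ`). [cite: BernsteinZelevinsky1976, §2] -/
theorem exists_eq_zero_of_not_mem_ball {f : (Fin N → v.adicCompletion F) → ℂ}
    (hf : f ∈ SchwartzBruhat (Fin N → v.adicCompletion F)) :
    ∃ m : ℤ, ∀ x, x ∉ {x : Fin N → v.adicCompletion F | ∀ i, Valued.v (x i) ≤ WithZero.exp (-(m : ℤ))} → f x = 0 := by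
  obtain ⟨n, hn⟩ := (hf.2 : HasCompactSupport f).isCompact.elim_directed_cover
    (fun n : ℕ => {x : Fin N → v.adicCompletion F | ∀ i, Valued.v (x i) ≤ WithZero.exp (-(-(n : ℤ) : ℤ))}) (fun n => (isClopen_ball v N (-(n : ℤ))).isOpen)
    (fun x _ => Set.mem_iUnion.2 (exists_mem_ball_neg_nat v N x))
    (fun a b => ⟨max a b, fun x hx i => (hx i).trans (by rw [WithZero.exp_le_exp]; omega),
      fun x hx i => (hx i).trans (by rw [WithZero.exp_le_exp]; omega)⟩)
  refine ⟨-(n : ℤ), fun x hx => ?_⟩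
  exact image_eq_zero_of_notMem_tsupport fun h => hx (hn h)

/-- **a Schwartz–Bruhat function on `F_vᴺ` is constant on some ball around `0`** (locally constant at `0`; the compact
balls `B_m`, `m ∈ ℕ`, shrink to `{0}`). [cite: BernsteinZelevinsky1976, §2] -/
theorem exists_eq_apply_zero_of_mem_ball {f : (Fin N → v.adicCompletion F) → ℂ}
    (hf : f ∈ SchwartzBruhat (Fin N → v.adicCompletion F)) :
    ∃ m : ℤ, ∀ x, x ∈ {x : Fin N → v.adicCompletion F | ∀ i, Valued.v (x i) ≤ WithZero.exp (-(m : ℤ))} → f x = f 0 := by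
  -- `U = f ⁻¹' {f 0}` is open; the compact sets `B_m ∖ U` decrease to `∅`
  have hU : IsOpen (f ⁻¹' {f 0}) := (hf.1 : IsLocallyConstant f).isOpen_fiber _
  have h0 : ∀ m : ℕ, (0 : Fin N → v.adicCompletion F) ∈ {x : Fin N → v.adicCompletion F | ∀ i, Valued.v (x i) ≤ WithZero.exp (-((m : ℤ) : ℤ))} := fun m i => by
    rw [Pi.zero_apply, map_zero]; exact zero_le
  obtain ⟨m, hm⟩ := ((isCompact_ball v N 0).diff hU).elim_directed_family_closed
    (fun m : ℕ => {x : Fin N → v.adicCompletion F | ∀ i, Valued.v (x i) ≤ WithZero.exp (-((m : ℤ) : ℤ))}) (fun m => (isClopen_ball v N m).isClosed)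
    (by
      ext x
      simp only [Set.mem_inter_iff, Set.mem_sdiff, Set.mem_iInter, Set.mem_preimage, Set.mem_singleton_iff,
        Set.mem_empty_iff_false, iff_false, not_and]
      intro hx hall
      exact hx.2 (by rw [eq_zero_of_forall_mem_ball v N x hall]))
    (fun a b => ⟨max a b, fun x hx i => (hx i).trans (by rw [WithZero.exp_le_exp]; omega),
      fun x hx i => (hx i).trans (by rw [WithZero.exp_le_exp]; omega)⟩)
  refine ⟨m, fun x hx => ?_⟩
  by_contra hne
  have hx0 : x ∈ {x : Fin N → v.adicCompletion F | ∀ i, Valued.v (x i) ≤ WithZero.exp (-((0 : ℤ) : ℤ))} := fun i => (hx i).trans (by rw [WithZero.exp_le_exp]; omega)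
  have : x ∈ ({x : Fin N → v.adicCompletion F | ∀ i, Valued.v (x i) ≤ WithZero.exp (-((0 : ℤ) : ℤ))} \ f ⁻¹' {f 0}) ∩ {x : Fin N → v.adicCompletion F | ∀ i, Valued.v (x i) ≤ WithZero.exp (-((m : ℤ) : ℤ))} := ⟨⟨hx0, hne⟩, hx⟩
  rw [hm] at this
  exact this

/-! ## §5 `GL_N(𝒪_v)`-invariant Schwartz–Bruhat functions are combinations of ball indicators -/

/-- **Spherical functions on `F_vᴺ`**: a Schwartz–Bruhat function invariant under `x ↦ g · x` for all `g ∈ GL_N(𝒪_v)` is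
a (finite) linear combination of the ball indicators `1_{B_m}` (`N ≥ 1`): it vanishes off `B_{m₀}`, equals `f 0` on
`B_{m₁}`, and is constant on each shell `B_m ∖ B_{m+1}` in between (`GLn.apply_eq_of_invariant_of_smul_primitive`).
[cite: BernsteinZelevinsky1976, §2] -/
theorem mem_span_indicator_ball_of_invariant (hN : 0 < N) {f : (Fin N → v.adicCompletion F) → ℂ}
    (hf : f ∈ SchwartzBruhat (Fin N → v.adicCompletion F))
    (hinv : ∀ g : GL (Fin N) (v.adicCompletion F), g ∈ glInt N (v.adicCompletion F) →
      ∀ x, f ((g : Matrix (Fin N) (Fin N) (v.adicCompletion F)) *ᵥ x) = f x) :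
    f ∈ Submodule.span ℂ (Set.range fun m : ℤ =>
      ({x : Fin N → v.adicCompletion F | ∀ i, Valued.v (x i) ≤ WithZero.exp (-(m : ℤ))}).indicator (fun _ => (1 : ℂ)) : Set ((Fin N → v.adicCompletion F) → ℂ)) := by
  classical
  obtain ⟨π, hπ⟩ := exists_valued_uniformiser v
  have hπ0 : π ≠ 0 := fun h => by rw [h, map_zero] at hπ; exact WithZero.exp_ne_zero hπ.symm
  obtain ⟨m₀, hm₀⟩ := exists_eq_zero_of_not_mem_ball v N hf
  obtain ⟨m₁, hm₁⟩ := exists_eq_apply_zero_of_mem_ball v N hf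
  -- the test vector `e₀` and the shell values `a m = f (π^m • e₀)`
  let i₀ : Fin N := ⟨0, hN⟩
  let e : Fin N → v.adicCompletion F := Pi.single i₀ 1
  have he : ∀ i, Valued.v (e i) ≤ 1 := fun i => by
    simp only [e, Pi.single_apply]
    split_ifs
    · rw [map_one]
    · rw [map_zero]; exact zero_le_one
  have he₁ : Valued.v (e i₀) = 1 := by simp only [e, Pi.single_eq_same, map_one]
  let ind : ℤ → (Fin N → v.adicCompletion F) → ℂ := fun m => ({x : Fin N → v.adicCompletion F | ∀ i, Valued.v (x i) ≤ WithZero.exp (-(m : ℤ))}).indicator fun _ => (1 : ℂ)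
  have hind : ∀ m, ind m ∈ Submodule.span ℂ (Set.range ind) := fun m => Submodule.subset_span ⟨m, rfl⟩
  -- membership of a vector of content `k` in the balls
  have hmem : ∀ (k m : ℤ) {x₀ : Fin N → v.adicCompletion F}, (∀ i, Valued.v (x₀ i) ≤ 1) → ∀ {j}, Valued.v (x₀ j) = 1 →
      (π ^ k • x₀ ∈ {x : Fin N → v.adicCompletion F | ∀ i, Valued.v (x i) ≤ WithZero.exp (-(m : ℤ))} ↔ m ≤ k) := fun k m x₀ hx₀ j hj => zpow_smul_mem_ball_iff_le v N hπ k m hx₀ hj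
  -- the candidate combination
  let g : (Fin N → v.adicCompletion F) → ℂ :=
    ∑ m ∈ Finset.Ico m₀ m₁, f (π ^ m • e) • (ind m - ind (m + 1)) + f 0 • ind m₁
  have hg : g ∈ Submodule.span ℂ (Set.range ind) := by
    refine Submodule.add_mem _ (Submodule.sum_mem _ fun m _ => Submodule.smul_mem _ _
      (Submodule.sub_mem _ (hind m) (hind (m + 1)))) (Submodule.smul_mem _ _ (hind m₁))
  suffices hfg : f = g by rw [hfg]; exact hg
  funext x
  simp only [g, Finset.sum_apply, Pi.add_apply, Pi.smul_apply, Pi.sub_apply, smul_eq_mul, ind]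
  by_cases hx : x = 0
  · -- at `0` every indicator is `1`
    subst hx
    have h1 : ∀ m : ℤ, ({x : Fin N → v.adicCompletion F | ∀ i, Valued.v (x i) ≤ WithZero.exp (-(m : ℤ))}).indicator (fun _ => (1 : ℂ)) 0 = 1 := fun m =>
      Set.indicator_of_mem (show (0 : Fin N → v.adicCompletion F) ∈
          {x : Fin N → v.adicCompletion F | ∀ i, Valued.v (x i) ≤ WithZero.exp (-(m : ℤ))} from
        fun i => by rw [Pi.zero_apply, map_zero]; exact zero_le) _
    simp only [h1, sub_self, mul_zero, Finset.sum_const_zero, zero_add, mul_one]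
  · -- content decomposition `x = π^k • x₀`
    obtain ⟨k, x₀, hx₀, ⟨j, hj⟩, rfl⟩ := exists_zpow_smul_primitive_eq v N hπ hx
    -- `f (π^k • x₀) = f (π^k • e)` (invariance, `GL_N(𝒪)` transitive on primitive vectors)
    have hfx : f (π ^ k • x₀) = f (π ^ k • e) := by
      obtain ⟨g₁, hg₁, h₁⟩ := GLn.exists_mem_glInt_mulVec_single_eq_of_valued v x₀ hx₀ j hj
      -- `e_j` and `e = e_{i₀}` are related inside `GL_N(𝒪)` (through `e_{i₀} + e_j`)
      obtain ⟨g₃, hg₃, h₃⟩ := GLn.exists_mem_glInt_mulVec_eq_of_primitive (K := v.adicCompletion F)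
        (Pi.single j (1 : v.adicCompletion F)) (Pi.single i₀ 1)
        (fun i => by rw [Pi.single_apply]; split_ifs; exacts [one_mem _, zero_mem _])
        (fun i => by rw [Pi.single_apply]; split_ifs; exacts [one_mem _, zero_mem _])
        (i₀ := j) (j₀ := i₀) (by rw [Pi.single_eq_same, map_one]) (by rw [Pi.single_eq_same, map_one])
      have e1 : f (π ^ k • x₀) = f (π ^ k • Pi.single j 1) := by
        rw [← h₁, ← Matrix.mulVec_smul, hinv g₁ hg₁]
      have e2 : f (π ^ k • Pi.single j (1 : v.adicCompletion F)) = f (π ^ k • e) := by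
        show f (π ^ k • Pi.single j (1 : v.adicCompletion F)) = f (π ^ k • Pi.single i₀ 1)
        rw [← h₃, ← Matrix.mulVec_smul, hinv g₃ hg₃]
      exact e1.trans e2
    have hI : ∀ m : ℤ, ({x : Fin N → v.adicCompletion F | ∀ i, Valued.v (x i) ≤ WithZero.exp (-(m : ℤ))}).indicator (fun _ => (1 : ℂ)) (π ^ k • x₀) = if m ≤ k then 1 else 0 := by
      intro m
      by_cases h : m ≤ k
      · rw [if_pos h, Set.indicator_of_mem ((hmem k m hx₀ hj).2 h)]
      · rw [if_neg h, Set.indicator_of_notMem (fun h' => h ((hmem k m hx₀ hj).1 h'))]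
    simp only [hI]
    -- the telescoping sum picks out the shell `m = k`
    have hsum : ∑ m ∈ Finset.Ico m₀ m₁, f (π ^ m • e) * ((if m ≤ k then (1 : ℂ) else 0) - if m + 1 ≤ k then 1 else 0) =
        if m₀ ≤ k ∧ k < m₁ then f (π ^ k • e) else 0 := by
      have hterm : ∀ m, f (π ^ m • e) * ((if m ≤ k then (1 : ℂ) else 0) - if m + 1 ≤ k then 1 else 0) =
          if m = k then f (π ^ k • e) else 0 := by
        intro m
        by_cases h1 : m = k
        · subst h1; simp
        · by_cases h2 : m ≤ k
          · have h3 : m + 1 ≤ k := by omega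
            rw [if_pos h2, if_pos h3, sub_self, mul_zero, if_neg h1]
          · have h3 : ¬ m + 1 ≤ k := by omega
            rw [if_neg h2, if_neg h3, sub_self, mul_zero, if_neg h1]
      simp_rw [hterm]
      simp only [Finset.sum_ite_eq', Finset.mem_Ico]
    rw [hsum]
    by_cases hlo : m₀ ≤ k
    · by_cases hhi : k < m₁
      · rw [if_pos ⟨hlo, hhi⟩, if_neg (not_le.2 hhi), mul_zero, add_zero]
        exact hfx
      · rw [if_neg (fun h => hhi h.2), zero_add, if_pos (not_lt.1 hhi), mul_one]
        exact hm₁ _ ((hmem k m₁ hx₀ hj).2 (not_lt.1 hhi))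
    · -- `k < m₀`: `f x = 0` (and `= f 0` if moreover `m₁ ≤ k`)
      rw [if_neg (fun h => hlo h.1), zero_add]
      by_cases hhi : m₁ ≤ k
      · rw [if_pos hhi, mul_one]
        exact hm₁ _ ((hmem k m₁ hx₀ hj).2 hhi)
      · rw [if_neg hhi, mul_zero]
        exact hm₀ _ (fun h' => hlo ((hmem k m₀ hx₀ hj).1 h'))

end Literature.NumberTheory.Automorphic.AdicBall
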